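import Mathlib.Analysis.Complex.CauchyIntegral
import Mathlib.Analysis.Complex.RemovableSingularity
import Mathlib.Analysis.SpecialFunctions.Complex.LogDeriv
import Mathlib.Analysis.SpecialFunctions.Integrals.Basic
import HarnessLib

/-!
# Cauchy's integral formula for a rectangle

Mathlib has the Cauchy–Goursat theorem for rectangles
(`Complex.integral_boundary_rect_eq_zero_of_differentiableOn`) and Cauchy's integral formula for
discs/annuli, but not the integral formula for a rectangle. This file supplies it:

* `Literature.Analysis.Complex.integral_boundary_rect_inv_sub` — the boundary integral of `(z - ρ)⁻¹` over the
  rectangle `[a, b] × [c, d]` (Mathlib's orientation convention) equals `2πi` when `ρ` is an interior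
  point (winding number one), computed with the principal logarithm as a primitive on three sides and
  with the two one-sided branches on the left side, where the boundary crosses the cut.
* `Literature.Analysis.Complex.integral_boundary_rect_div_sub_eq` — Cauchy's integral formula: for `f` holomorphic on
  the closed rectangle and `ρ` interior,
  `∮_{∂R} f(z)/(z - ρ) dz = 2πi · f(ρ)` (same four-term convention), from Cauchy–Goursat applied to
  `dslope f ρ`.

Standard textbook material (e.g. Ahlfors, *Complex Analysis*, 3rd ed., ch. 4 §2.2, Lemma 2 and
Thm. 6); tagged folklore.
-/

noncomputable section

open Complex Set MeasureTheory Filter Topology intervalIntegral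

namespace Literature.Analysis.Complex

/-! ### Primitives of `(z - ρ)⁻¹` along horizontal and vertical segments -/

/-- Horizontal segment not passing through the cut: `∫_a^b dx/(x + y i - ρ) = log(b + yi - ρ) -
log(a + yi - ρ)` when `y ≠ Im ρ`. [folklore] -/
lemma integral_inv_sub_horizontal (ρ : ℂ) (a b y : ℝ) (hy : y ≠ ρ.im) :
    ∫ x : ℝ in a..b, ((x : ℂ) + y * I - ρ)⁻¹ =
      log ((b : ℂ) + y * I - ρ) - log ((a : ℂ) + y * I - ρ) := by
  have hslit : ∀ x : ℝ, (x : ℂ) + y * I - ρ ∈ slitPlane := by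
    intro x
    refine Or.inr ?_
    simp [sub_eq_zero, hy]
  have hderiv : ∀ x : ℝ, HasDerivAt (fun x : ℝ ↦ log ((x : ℂ) + y * I - ρ))
      (((x : ℂ) + y * I - ρ)⁻¹) x := by
    intro x
    have h1 : HasDerivAt (fun w : ℂ ↦ w + y * I - ρ) 1 (x : ℂ) :=
      ((hasDerivAt_id (x : ℂ)).add_const _).sub_const _
    have h2 := h1.clog (hslit x)
    rw [one_div] at h2
    exact h2.comp_ofReal
  have hcont : Continuous fun x : ℝ ↦ ((x : ℂ) + y * I - ρ)⁻¹ := by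
    refine Continuous.inv₀ (by fun_prop) fun x ↦ ?_
    exact slitPlane_ne_zero (hslit x)
  exact integral_eq_sub_of_hasDerivAt (fun x _ ↦ hderiv x) (hcont.intervalIntegrable _ _)

/-- Vertical segment to the right of `ρ`: `∫_c^d i dy/(x + yi - ρ) = log(x + di - ρ) - log(x + ci - ρ)`
when `x > Re ρ`. [folklore] -/
lemma integral_inv_sub_vertical_right (ρ : ℂ) (x c d : ℝ) (hx : ρ.re < x) :
    I * ∫ y : ℝ in c..d, ((x : ℂ) + y * I - ρ)⁻¹ =
      log ((x : ℂ) + d * I - ρ) - log ((x : ℂ) + c * I - ρ) := by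
  have hslit : ∀ y : ℝ, (x : ℂ) + y * I - ρ ∈ slitPlane := by
    intro y
    refine Or.inl ?_
    simp; linarith
  have hderiv : ∀ y : ℝ, HasDerivAt (fun y : ℝ ↦ log ((x : ℂ) + y * I - ρ))
      (I * ((x : ℂ) + y * I - ρ)⁻¹) y := by
    intro y
    have h1 : HasDerivAt (fun w : ℂ ↦ (x : ℂ) + w * I - ρ) (1 * I) (y : ℂ) :=
      (((hasDerivAt_id (y : ℂ)).mul_const I).const_add _).sub_const _
    have h2 := h1.clog (hslit y)
    rw [one_mul, div_eq_mul_inv] at h2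
    exact h2.comp_ofReal
  have hcont : Continuous fun y : ℝ ↦ ((x : ℂ) + y * I - ρ)⁻¹ := by
    refine Continuous.inv₀ (by fun_prop) fun y ↦ ?_
    exact slitPlane_ne_zero (hslit y)
  rw [← intervalIntegral.integral_const_mul]
  exact integral_eq_sub_of_hasDerivAt (fun y _ ↦ hderiv y) ((hcont.const_mul I).intervalIntegrable _ _)

/-- Vertical segment to the left of `ρ`, crossing the cut of `log (· - ρ)` at height `Im ρ`:
`∫_c^d i dy/(x + yi - ρ) = log(x + di - ρ) - log(x + ci - ρ) - 2πi` for `x < Re ρ`,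
`c < Im ρ < d` (the principal logarithm jumps by `2πi` across the negative real axis). [folklore] -/
lemma integral_inv_sub_vertical_left (ρ : ℂ) (x c d : ℝ) (hx : x < ρ.re) (hc : c < ρ.im)
    (hd : ρ.im < d) :
    I * ∫ y : ℝ in c..d, ((x : ℂ) + y * I - ρ)⁻¹ =
      log ((x : ℂ) + d * I - ρ) - log ((x : ℂ) + c * I - ρ) - 2 * Real.pi * I := by
  set γ := ρ.im with hγ
  set φ : ℝ → ℂ := fun y ↦ (x : ℂ) + y * I - ρ with hφ
  have hφre : ∀ y, (φ y).re = x - ρ.re := by intro y; simp [hφ]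
  have hφim : ∀ y, (φ y).im = y - γ := by intro y; simp [hφ, hγ]
  have hφne : ∀ y, φ y ≠ 0 := by
    intro y h
    have := congrArg Complex.re h
    rw [hφre] at this
    simp only [zero_re] at this
    linarith
  have hφcont : Continuous φ := by simp only [hφ]; fun_prop
  have hcont : Continuous fun y : ℝ ↦ (φ y)⁻¹ := hφcont.inv₀ hφne
  have hderivφ : ∀ y : ℝ, HasDerivAt (fun w : ℂ ↦ (x : ℂ) + w * I - ρ) (1 * I) (y : ℂ) := fun y ↦
    (((hasDerivAt_id (y : ℂ)).mul_const I).const_add _).sub_const _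
  -- derivative of `log ∘ φ` away from the crossing point
  have hderiv : ∀ y : ℝ, y ≠ γ → HasDerivAt (fun y : ℝ ↦ log (φ y)) (I * (φ y)⁻¹) y := by
    intro y hy
    have hslit : (x : ℂ) + (y : ℂ) * I - ρ ∈ slitPlane := by
      refine Or.inr ?_
      have := hφim y
      simp only [hφ] at this
      rw [this]; exact sub_ne_zero.mpr hy
    have h2 := (hderivφ y).clog hslit
    rw [one_mul, div_eq_mul_inv] at h2
    exact h2.comp_ofReal
  -- the crossing point `φ γ` lies on the negative real axis
  have hγre : (φ γ).re < 0 := by rw [hφre]; linarith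
  have hγim : (φ γ).im = 0 := by rw [hφim]; ring
  have hlogγ : log (φ γ) = Real.log ‖φ γ‖ + Real.pi * I := by
    rw [Complex.log, (arg_eq_pi_iff.mpr ⟨hγre, hγim⟩)]
  -- split the integral at `γ`
  have hint : ∀ u v : ℝ, IntervalIntegrable (fun y : ℝ ↦ I * (φ y)⁻¹) volume u v := fun u v ↦
    (hcont.const_mul I).intervalIntegrable _ _
  rw [← intervalIntegral.integral_const_mul,
    ← integral_add_adjacent_intervals (hint c γ) (hint γ d)]
  -- lower part: primitive with the limit value from below at `γ`
  set Lm : ℂ := Real.log ‖φ γ‖ - Real.pi * I with hLm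
  have hlow : ∫ y : ℝ in c..γ, I * (φ y)⁻¹ = Lm - log (φ c) := by
    classical
    set P : ℝ → ℂ := Function.update (fun y : ℝ ↦ log (φ y)) γ Lm with hP
    have hPc : P c = log (φ c) := by
      rw [hP, Function.update_of_ne hc.ne]
    have hPγ : P γ = Lm := by rw [hP, Function.update_self]
    rw [← hPc, ← hPγ]
    refine integral_eq_sub_of_hasDerivAt_of_le hc.le ?_ ?_ (hint c γ)
    · intro y hy
      rcases eq_or_ne y γ with rfl | hne
      · -- continuity from the left at the crossing point
        rw [hP, continuousWithinAt_update_same]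
        have hmaps : MapsTo φ (Iio γ) {z : ℂ | z.im < 0} := by
          intro t ht
          simp only [mem_setOf_eq, hφim]
          simp only [mem_Iio] at ht
          linarith
        have h1 : Tendsto φ (𝓝[Iio γ] γ) (𝓝[{z : ℂ | z.im < 0}] (φ γ)) :=
          hφcont.continuousWithinAt.tendsto_nhdsWithin hmaps
        have h2 := (tendsto_log_nhdsWithin_im_neg_of_re_neg_of_im_zero hγre hγim).comp h1
        refine (h2.mono_left (nhdsWithin_mono _ ?_))
        intro t ht
        exact lt_of_le_of_ne ht.1.2 ht.2
      · have hy' : y < γ := lt_of_le_of_ne hy.2 hne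
        have hca : ContinuousAt (fun y : ℝ ↦ log (φ y)) y := (hderiv y hne).continuousAt
        have : ContinuousAt P y := by
          rw [hP]
          exact (continuousAt_update_of_ne hne).mpr hca
        exact this.continuousWithinAt
    · intro y hy
      have hne : y ≠ γ := hy.2.ne
      refine (hderiv y hne).congr_of_eventuallyEq ?_
      filter_upwards [eventually_ne_nhds hne] with t ht
      rw [hP, Function.update_of_ne ht]
  -- upper part: the principal branch is continuous from above at `γ`
  have hup : ∫ y : ℝ in γ..d, I * (φ y)⁻¹ = log (φ d) - log (φ γ) := by
    refine integral_eq_sub_of_hasDerivAt_of_le hd.le ?_ (fun y hy ↦ hderiv y hy.1.ne') (hint γ d)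
    intro y hy
    rcases eq_or_ne y γ with rfl | hne
    · have hmaps : MapsTo φ (Icc γ d) {z : ℂ | 0 ≤ z.im} := by
        intro t ht
        simp only [mem_setOf_eq, hφim]
        linarith [ht.1]
      exact (continuousWithinAt_log_of_re_neg_of_im_zero hγre hγim).comp
        hφcont.continuousWithinAt hmaps
    · exact (hderiv y hne).continuousAt.continuousWithinAt
  rw [hlow, hup, hlogγ, hLm]
  simp only [hφ]
  ring

/-- **Winding number of a rectangle about an interior point.** For `a < Re ρ < b` and
`c < Im ρ < d`, the boundary integral of `(z - ρ)⁻¹` over the rectangle `[a,b] × [c,d]`, in the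
four-term convention of Mathlib's `Complex.integral_boundary_rect_eq_zero_of_differentiableOn`
(bottom − top + i·right − i·left), equals `2πi`. [folklore] -/
theorem integral_boundary_rect_inv_sub (ρ : ℂ) {a b c d : ℝ} (ha : a < ρ.re) (hb : ρ.re < b)
    (hc : c < ρ.im) (hd : ρ.im < d) :
    (∫ x : ℝ in a..b, ((x : ℂ) + c * I - ρ)⁻¹) - (∫ x : ℝ in a..b, ((x : ℂ) + d * I - ρ)⁻¹) +
      I * (∫ y : ℝ in c..d, ((b : ℂ) + y * I - ρ)⁻¹) -
      I * (∫ y : ℝ in c..d, ((a : ℂ) + y * I - ρ)⁻¹) = 2 * Real.pi * I := by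
  rw [integral_inv_sub_horizontal ρ a b c hc.ne, integral_inv_sub_horizontal ρ a b d hd.ne',
    integral_inv_sub_vertical_right ρ b c d hb, integral_inv_sub_vertical_left ρ a c d ha hc hd]
  ring

/-! ### Cauchy's integral formula for a rectangle -/

/-- **Cauchy's integral formula for a rectangle.** Let `f` be complex differentiable on the closed
rectangle `[a,b] × [c,d]` and let `ρ` be an interior point. Then, in Mathlib's four-term boundary
convention (bottom − top + i·right − i·left),
`∮_{∂R} f(z)/(z - ρ) dz = 2πi · f(ρ)`. Proof: Cauchy–Goursat for `dslope f ρ` plus the winding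
integral `integral_boundary_rect_inv_sub`. [folklore] -/
theorem integral_boundary_rect_div_sub_eq {f : ℂ → ℂ} (ρ : ℂ) {a b c d : ℝ} (ha : a < ρ.re)
    (hb : ρ.re < b) (hc : c < ρ.im) (hd : ρ.im < d)
    (hf : DifferentiableOn ℂ f (Icc a b ×ℂ Icc c d)) :
    (∫ x : ℝ in a..b, f ((x : ℂ) + c * I) / ((x : ℂ) + c * I - ρ)) -
      (∫ x : ℝ in a..b, f ((x : ℂ) + d * I) / ((x : ℂ) + d * I - ρ)) +
      I * (∫ y : ℝ in c..d, f ((b : ℂ) + y * I) / ((b : ℂ) + y * I - ρ)) -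
      I * (∫ y : ℝ in c..d, f ((a : ℂ) + y * I) / ((a : ℂ) + y * I - ρ)) =
      2 * Real.pi * I * f ρ := by
  have hab : a ≤ b := (ha.trans hb).le
  have hcd : c ≤ d := (hc.trans hd).le
  -- the closed rectangle is a neighbourhood of ρ
  have hR : Icc a b ×ℂ Icc c d ∈ 𝓝 ρ := by
    refine mem_of_superset ((isOpen_Ioo.reProdIm isOpen_Ioo).mem_nhds
      (show ρ ∈ Ioo a b ×ℂ Ioo c d from ⟨⟨ha, hb⟩, ⟨hc, hd⟩⟩)) ?_
    exact fun z hz ↦ ⟨Ioo_subset_Icc_self hz.1, Ioo_subset_Icc_self hz.2⟩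
  set g : ℂ → ℂ := dslope f ρ with hg
  have hgd : DifferentiableOn ℂ g (Icc a b ×ℂ Icc c d) := (differentiableOn_dslope hR).mpr hf
  -- Cauchy–Goursat for g on the rectangle with corners a + c i, b + d i
  have hCG := Complex.integral_boundary_rect_eq_zero_of_differentiableOn g (a + c * I) (b + d * I)
    (by simpa [uIcc_of_le hab, uIcc_of_le hcd] using hgd)
  simp only [add_re, ofReal_re, mul_re, I_re, mul_zero, ofReal_im, I_im, mul_one, sub_self,
    add_zero, add_im, mul_im, zero_add, smul_eq_mul] at hCG
  -- on the boundary, g = f/(z-ρ) - f ρ · (z-ρ)⁻¹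
  have hgpt : ∀ z : ℂ, z ≠ ρ → g z = f z / (z - ρ) - f ρ * (z - ρ)⁻¹ := by
    intro z hz
    rw [hg, dslope_of_ne _ hz, slope_def_module]
    rw [smul_eq_mul, div_eq_inv_mul]; ring
  have hne_h : ∀ (x y : ℝ), y ≠ ρ.im → (x : ℂ) + y * I ≠ ρ := by
    intro x y hy h
    apply hy
    have := congrArg Complex.im h
    simpa using this
  have hne_v : ∀ (x y : ℝ), x ≠ ρ.re → (x : ℂ) + y * I ≠ ρ := by
    intro x y hx h
    apply hx
    have := congrArg Complex.re h
    simpa using this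
  -- continuity of f on the rectangle, transported to the four sides
  have hfc : ContinuousOn f (Icc a b ×ℂ Icc c d) := hf.continuousOn
  have hside_h : ∀ y : ℝ, y ∈ Icc c d → y ≠ ρ.im →
      IntervalIntegrable (fun x : ℝ ↦ f ((x : ℂ) + y * I) / ((x : ℂ) + y * I - ρ)) volume a b ∧
      IntervalIntegrable (fun x : ℝ ↦ ((x : ℂ) + y * I - ρ)⁻¹) volume a b := by
    intro y hy hyne
    have hden : ∀ x : ℝ, (x : ℂ) + y * I - ρ ≠ 0 := fun x ↦ sub_ne_zero.mpr (hne_h x y hyne)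
    have h1 : ContinuousOn (fun x : ℝ ↦ f ((x : ℂ) + y * I)) (uIcc a b) := by
      rw [uIcc_of_le hab]
      refine hfc.comp (by fun_prop) ?_
      intro x hx
      exact ⟨by simpa using hx, by simpa using hy⟩
    have h2 : Continuous (fun x : ℝ ↦ ((x : ℂ) + y * I - ρ)⁻¹) :=
      Continuous.inv₀ (by fun_prop) hden
    refine ⟨?_, h2.intervalIntegrable _ _⟩
    simp_rw [div_eq_mul_inv]
    exact (h1.mul h2.continuousOn).intervalIntegrable
  have hside_v : ∀ x : ℝ, x ∈ Icc a b → x ≠ ρ.re →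
      IntervalIntegrable (fun y : ℝ ↦ f ((x : ℂ) + y * I) / ((x : ℂ) + y * I - ρ)) volume c d ∧
      IntervalIntegrable (fun y : ℝ ↦ ((x : ℂ) + y * I - ρ)⁻¹) volume c d := by
    intro x hx hxne
    have hden : ∀ y : ℝ, (x : ℂ) + y * I - ρ ≠ 0 := fun y ↦ sub_ne_zero.mpr (hne_v x y hxne)
    have h1 : ContinuousOn (fun y : ℝ ↦ f ((x : ℂ) + y * I)) (uIcc c d) := by
      rw [uIcc_of_le hcd]
      refine hfc.comp (by fun_prop) ?_
      intro y hy
      exact ⟨by simpa using hx, by simpa using hy⟩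
    have h2 : Continuous (fun y : ℝ ↦ ((x : ℂ) + y * I - ρ)⁻¹) :=
      Continuous.inv₀ (by fun_prop) hden
    refine ⟨?_, h2.intervalIntegrable _ _⟩
    simp_rw [div_eq_mul_inv]
    exact (h1.mul h2.continuousOn).intervalIntegrable
  -- rewrite each side integral of g
  have hbot : ∫ x : ℝ in a..b, g ((x : ℂ) + c * I) =
      (∫ x : ℝ in a..b, f ((x : ℂ) + c * I) / ((x : ℂ) + c * I - ρ)) -
        f ρ * ∫ x : ℝ in a..b, ((x : ℂ) + c * I - ρ)⁻¹ := by
    obtain ⟨h1, h2⟩ := hside_h c (left_mem_Icc.mpr hcd) hc.ne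
    rw [← intervalIntegral.integral_const_mul, ← intervalIntegral.integral_sub h1 (h2.const_mul _)]
    refine intervalIntegral.integral_congr fun x _ ↦ ?_
    exact hgpt _ (hne_h x c hc.ne)
  have htop : ∫ x : ℝ in a..b, g ((x : ℂ) + d * I) =
      (∫ x : ℝ in a..b, f ((x : ℂ) + d * I) / ((x : ℂ) + d * I - ρ)) -
        f ρ * ∫ x : ℝ in a..b, ((x : ℂ) + d * I - ρ)⁻¹ := by
    obtain ⟨h1, h2⟩ := hside_h d (right_mem_Icc.mpr hcd) hd.ne'
    rw [← intervalIntegral.integral_const_mul, ← intervalIntegral.integral_sub h1 (h2.const_mul _)]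
    refine intervalIntegral.integral_congr fun x _ ↦ ?_
    exact hgpt _ (hne_h x d hd.ne')
  have hright : ∫ y : ℝ in c..d, g ((b : ℂ) + y * I) =
      (∫ y : ℝ in c..d, f ((b : ℂ) + y * I) / ((b : ℂ) + y * I - ρ)) -
        f ρ * ∫ y : ℝ in c..d, ((b : ℂ) + y * I - ρ)⁻¹ := by
    obtain ⟨h1, h2⟩ := hside_v b (right_mem_Icc.mpr hab) hb.ne'
    rw [← intervalIntegral.integral_const_mul, ← intervalIntegral.integral_sub h1 (h2.const_mul _)]
    refine intervalIntegral.integral_congr fun y _ ↦ ?_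
    exact hgpt _ (hne_v b y hb.ne')
  have hleft : ∫ y : ℝ in c..d, g ((a : ℂ) + y * I) =
      (∫ y : ℝ in c..d, f ((a : ℂ) + y * I) / ((a : ℂ) + y * I - ρ)) -
        f ρ * ∫ y : ℝ in c..d, ((a : ℂ) + y * I - ρ)⁻¹ := by
    obtain ⟨h1, h2⟩ := hside_v a (left_mem_Icc.mpr hab) ha.ne
    rw [← intervalIntegral.integral_const_mul, ← intervalIntegral.integral_sub h1 (h2.const_mul _)]
    refine intervalIntegral.integral_congr fun y _ ↦ ?_
    exact hgpt _ (hne_v a y ha.ne)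
  rw [hbot, htop, hright, hleft] at hCG
  have hw := integral_boundary_rect_inv_sub ρ ha hb hc hd
  linear_combination hCG + f ρ * hw

end Literature.Analysis.Complex

end
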